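import Summits.CriticalPhenomena.SAWScalingLimit.Theorems.SAWWeldingIdentificationWeldingContinuityThreePoint

/-!
# Welding continuity, part C2: the normalised uniformiser of a bank with prescribed sign

Support file for item `stmt-CriticalPhenomena-4509` (`SAWWeldingIdentification.WeldingContinuity`).

For a Jordan domain `D` (a bank), parameters `0 < t_b < t_c < 1` of three boundary points
`p_a = β 0`, `p_b = β t_b`, `p_c = β t_c`, a conformal disc chart `f : 𝔻 → D` with Carathéodory
extension `F`, and a sign `ε = ±1` with `index β = -ε`, we produce (`exists_normalisedMap`) the
circle preimages `ζ_a, ζ_b, ζ_c`, the real Cayley parameters `u, u'` of `ζ_b⁻¹ ζ_a`, `ζ_b⁻¹ ζ_c`,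
the fact `|u' - u| ε = u' - u` (orientation, part C), and the conformal equivalence
`φ : (ℍₒ; 0, ∞, ε) → (D; p_a, p_b, p_c)` with the explicit boundary behaviour
`φ → F (ζ_b · cayleyFun (|u' - u| y + u))` at every `y` of the closed half-plane.

References: Ahlfors (1979), Ch. 6 §1.1; Pommerenke (1992), Thm. 2.6, Cor. 2.7.
-/

noncomputable section

open Set Filter Metric Complex
open scoped Topology
open UpperHalfPlane (upperHalfPlaneSet)
open Literature.Probability.RandomPlanarGeometry Literature.Topology.PlaneTopology

namespace Summit.CriticalPhenomena.SAWScalingLimit.Theorems.WeldingContinuity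

/-- A unit complex number `w ≠ 1` is `cayleyFun u` for the real number `u = re (cayleyInvFun w)`.
[folklore] -/
theorem cayleyFun_re_cayleyInvFun {w : ℂ} (hw : ‖w‖ = 1) (hw1 : w ≠ 1) :
    cayleyFun ((cayleyInvFun w).re : ℂ) = w := by
  rw [← cayleyInvFun_eq_ofReal_re hw, cayleyFun_cayleyInvFun hw1]

/-- For unit complex numbers `ζ ≠ η`, the quotient `η⁻¹ ζ` is a unit complex number `≠ 1`.
[folklore] -/
theorem norm_inv_mul_eq_one {ζ η : ℂ} (hζ : ‖ζ‖ = 1) (hη : ‖η‖ = 1) :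
    ‖η⁻¹ * ζ‖ = 1 := by
  rw [norm_mul, norm_inv, hζ, hη, inv_one, one_mul]

/-- For unit complex numbers `ζ ≠ η`, the quotient `η⁻¹ ζ` is `≠ 1`. [folklore] -/
theorem inv_mul_ne_one {ζ η : ℂ} (hη : ‖η‖ = 1) (hne : ζ ≠ η) : η⁻¹ * ζ ≠ 1 := by
  intro h
  have hη0 : η ≠ 0 := norm_ne_zero_iff.1 (by rw [hη]; exact one_ne_zero)
  apply hne
  have : η * (η⁻¹ * ζ) = η := by rw [h, mul_one]
  rwa [← mul_assoc, mul_inv_cancel₀ hη0, one_mul] at this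

/-- `η (η⁻¹ ζ) = ζ` for a unit complex number `η`. [folklore] -/
theorem mul_inv_mul_cancel_of_norm {ζ η : ℂ} (hη : ‖η‖ = 1) : η * (η⁻¹ * ζ) = ζ := by
  have hη0 : η ≠ 0 := norm_ne_zero_iff.1 (by rw [hη]; exact one_ne_zero)
  rw [← mul_assoc, mul_inv_cancel₀ hη0, one_mul]

/-- **The normalised uniformiser of a bank with prescribed sign.** Let `D` be a Jordan domain,
`z₀ ∈ D`, `0 < t_b < t_c < 1`, `f : 𝔻 → D` a conformal equivalence with Carathéodory extension
`F` (continuous and injective on `𝔻̄`, equal to `f` on `𝔻`, circle onto `∂D`), and `ε = ±1`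
with `D.index z₀ = -ε`. Then there are circle points `ζ_a, ζ_b, ζ_c` over `β 0, β t_b, β t_c`,
with real Cayley parameters `u` of `ζ_b⁻¹ ζ_a` and `u'` of `ζ_b⁻¹ ζ_c` satisfying
`|u' - u| ε = u' - u ≠ 0`, and a conformal equivalence `φ : ℍₒ → D` with
`φ → F (ζ_b · cayleyFun (|u' - u| y + u))` within `ℍₒ` at every `y` with `im y ≥ 0` and `φ → F ζ_b`
at infinity; in particular `φ` has boundary values `β 0` at `0`, `β t_b` at `∞` and `β t_c` at
`ε`. [cite: PommerenkeBBCM1992, §2.3 Thm. 2.6 and Cor. 2.7] -/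
theorem exists_normalisedMap (D : JordanDomain) {z₀ : ℂ} (hz₀ : z₀ ∈ D.carrier) {tb tc : ℝ}
    (htb : 0 < tb) (hbc : tb < tc) (htc : tc < 1)
    (f : ConformalEquiv (ball (0 : ℂ) 1) D.carrier) {F : ℂ → ℂ}
    (hFc : ContinuousOn F (closedBall 0 1)) (hFeq : EqOn F f (ball 0 1))
    (hFinj : InjOn F (closedBall 0 1)) (hFsph : BijOn F (sphere 0 1) (frontier D.carrier))
    {ε : ℝ} (hε : ε = 1 ∨ ε = -1) (hidx : (D.index z₀ : ℝ) = -ε) :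
    ∃ (ζa ζb ζc : ℂ) (u u' : ℝ) (φ : ConformalEquiv upperHalfPlaneSet D.carrier),
      ζa ∈ sphere (0 : ℂ) 1 ∧ ζb ∈ sphere (0 : ℂ) 1 ∧ ζc ∈ sphere (0 : ℂ) 1 ∧
      F ζa = D.boundary 0 ∧ F ζb = D.boundary tb ∧ F ζc = D.boundary tc ∧
      u = (cayleyInvFun (ζb⁻¹ * ζa)).re ∧ u' = (cayleyInvFun (ζb⁻¹ * ζc)).re ∧
      u' - u ≠ 0 ∧ |u' - u| * ε = u' - u ∧
      (∀ y : ℂ, 0 ≤ y.im → Tendsto φ (𝓝[upperHalfPlaneSet] y)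
        (𝓝 (F (ζb * cayleyFun ((|u' - u| : ℝ) * y + u))))) ∧
      Tendsto φ (cocompact ℂ ⊓ 𝓟 upperHalfPlaneSet) (𝓝 (F ζb)) ∧
      φ.HasBoundaryValue 0 (D.boundary 0) ∧ φ.HasBoundaryValueAtInfty (D.boundary tb) ∧
      φ.HasBoundaryValue (ε : ℂ) (D.boundary tc) := by
  -- circle preimages of the three boundary points
  obtain ⟨ζa, hζa, hFa⟩ := hFsph.surjOn (D.boundary_mem_frontier 0)
  obtain ⟨ζb, hζb, hFb⟩ := hFsph.surjOn (D.boundary_mem_frontier tb)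
  obtain ⟨ζc, hζc, hFc'⟩ := hFsph.surjOn (D.boundary_mem_frontier tc)
  have hζa1 : ‖ζa‖ = 1 := mem_sphere_zero_iff_norm.1 hζa
  have hζb1 : ‖ζb‖ = 1 := mem_sphere_zero_iff_norm.1 hζb
  have hζc1 : ‖ζc‖ = 1 := mem_sphere_zero_iff_norm.1 hζc
  -- the three boundary points are distinct
  have hinj := D.injOn_boundary
  have h0m : (0 : ℝ) ∈ Ico (0 : ℝ) 1 := ⟨le_rfl, zero_lt_one⟩
  have hbm : tb ∈ Ico (0 : ℝ) 1 := ⟨htb.le, hbc.trans htc⟩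
  have hcm : tc ∈ Ico (0 : ℝ) 1 := ⟨(htb.trans hbc).le, htc⟩
  have hab : ζa ≠ ζb := fun h => by
    have : D.boundary 0 = D.boundary tb := by rw [← hFa, ← hFb, h]
    exact absurd (hinj h0m hbm this) htb.ne
  have hcb : ζc ≠ ζb := fun h => by
    have : D.boundary tc = D.boundary tb := by rw [← hFc', ← hFb, h]
    exact absurd (hinj hcm hbm this) hbc.ne'
  have hac : ζa ≠ ζc := fun h => by
    have : D.boundary 0 = D.boundary tc := by rw [← hFa, ← hFc', h]
    exact absurd (hinj h0m hcm this) (htb.trans hbc).ne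
  -- the Cayley parameters
  set u : ℝ := (cayleyInvFun (ζb⁻¹ * ζa)).re with hu
  set u' : ℝ := (cayleyInvFun (ζb⁻¹ * ζc)).re with hu'
  have hcu : ζb * cayleyFun u = ζa := by
    rw [hu, cayleyFun_re_cayleyInvFun (norm_inv_mul_eq_one hζa1 hζb1) (inv_mul_ne_one hζb1 hab),
      mul_inv_mul_cancel_of_norm hζb1]
  have hcu' : ζb * cayleyFun u' = ζc := by
    rw [hu', cayleyFun_re_cayleyInvFun (norm_inv_mul_eq_one hζc1 hζb1) (inv_mul_ne_one hζb1 hcb),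
      mul_inv_mul_cancel_of_norm hζb1]
  -- orientation: `|u' - u| ε = u' - u`
  have hsign := threePoint_lt_iff D hz₀ htb hbc htc f hFc hFeq hFinj hFsph hζa hζb hζc hFa hFb hFc'
    hcu hcu'
  have hidx' : D.index z₀ = 1 ∨ D.index z₀ = -1 := D.index_eq_one_or_eq_neg_one hz₀
  have hv : |u' - u| * ε = u' - u := by
    rcases hε with rfl | rfl
    · have hi : D.index z₀ = -1 := by
        rcases hidx' with h | h
        · rw [h] at hidx; norm_num at hidx
        · exact h
      have hlt : u < u' := hsign.2 hi
      rw [mul_one, abs_of_pos (sub_pos.2 hlt)]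
    · have hi : D.index z₀ = 1 := by
        rcases hidx' with h | h
        · exact h
        · rw [h] at hidx; norm_num at hidx
      have hlt : u' < u := hsign.1 hi
      rw [mul_neg, mul_one, abs_of_neg (sub_neg.2 hlt), neg_neg]
  have hne : u ≠ u' := fun h => by
    apply hac
    rw [← hcu, ← hcu', h]
  have hv0 : u' - u ≠ 0 := sub_ne_zero.2 (Ne.symm hne)
  have hvpos : 0 < |u' - u| := abs_pos.2 hv0
  -- the map
  obtain ⟨φ, -, hφ, hφinf⟩ := exists_threePointMap D f hFc hFeq hζb1 u hvpos
  refine ⟨ζa, ζb, ζc, u, u', φ, hζa, hζb, hζc, hFa, hFb, hFc', rfl, rfl, hv0, hv, hφ, hφinf, ?_, ?_, ?_⟩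
  · have h := hφ 0 (by simp)
    rw [mul_zero, zero_add, hcu, hFa] at h
    exact h
  · rwa [hFb] at hφinf
  · have h := hφ (ε : ℂ) (by simp)
    have e : ((|u' - u| : ℝ) : ℂ) * (ε : ℂ) + (u : ℂ) = ((u' : ℝ) : ℂ) := by
      have : |u' - u| * ε + u = u' := by rw [hv]; ring
      exact_mod_cast this
    rw [e, hcu', hFc'] at h
    exact h

end Summit.CriticalPhenomena.SAWScalingLimit.Theorems.WeldingContinuity

end
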